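import Summits.Ventures.WeilGRH.SelbergLatticeInterior
import HarnessLib

/-!
# rh-explicit (venture WeilGRH): THE BEURLING–SELBERG FUNCTIONS OF A LATTICE WINDOW ARE FINITE `sinc` FORMS, II —
  the exterior, the lattice points, and the two inequalities for every `y`

Cell `rh-explicit`, WEIL TRACK (structure seat weil-3, gen13).  Pure real analysis; continuation of
`SelbergLatticeInterior.lean` (notation and proof idea there).  With

  `M_N(y) = Σ_{m=0}^{N} sinc²(π(y−m)) − (−1)^N N·sinc(πy)·sinc(π(y−N))`,
  `m_N(y) = Σ_{m=1}^{N−1} sinc²(π(y−m)) − (−1)^N N·sinc(πy)·sinc(π(y−N))`: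

* `indicator_Icc_le_selbergLattice` — **`𝟙_{[0,N]}(y) ≤ M_N(y)` for every `N ∈ ℕ` and every real `y`**
  (`N = 0`: the Fejér kernel majorises a point);
* `selbergLattice_le_indicator_Ioo` — **`m_N(y) ≤ 𝟙_{(0,N)}(y)` for every `N ∈ ℕ` and every real `y`**.

These are the Beurling–Selberg majorant / minorant of exponential type `2π` of an interval of INTEGER length
`N` (Vaaler 1985 Thm. 8 with `Δ = 1`; `∫M_N = N + 1`, `∫m_N = N − 1`), written as finite `sinc` forms; the
measure-side use is `WeilSelbergWindows.lean`.

No definitions, no named facts; RH-free.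
-/

set_option autoImplicit false

noncomputable section

open Real Set Filter Finset
open scoped Topology BigOperators

namespace Summit.Ventures.WeilGRH

open Literature.Analysis.Fourier (sinc_pi_mul_add_nat_sq sinc_sq_le_one)

/-! ## Telescoping comparisons for the exterior cases -/

/-- Two more telescoping comparisons (interior sums over `Ico 1 N`, and the reflected forms for `y > N`). -/
theorem sum_Ico_inv_sq_le {z : ℝ} (hz : 0 < z) {N : ℕ} (hN : 1 ≤ N) :
    ∑ m ∈ Finset.Ico 1 N, 1 / (z + m) ^ 2 ≤ 1 / z - 1 / (z + N - 1) := by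
  induction N, hN using Nat.le_induction with
  | base =>
    simp only [Finset.Ico_self, Finset.sum_empty, Nat.cast_one, add_sub_cancel_right, sub_self, le_refl]
  | succ K hK ih =>
    rw [Finset.sum_Ico_succ_top hK]
    have hK' : (1 : ℝ) ≤ K := by exact_mod_cast hK
    have h1 : 0 < z + K - 1 := by linarith
    have h2 : 0 < z + K := by linarith
    have hstep : 1 / (z + K) ^ 2 ≤ 1 / (z + K - 1) - 1 / (z + K) := by
      rw [div_sub_div _ _ h1.ne' h2.ne', div_le_div_iff₀ (by positivity) (by positivity)]
      nlinarith
    have e : z + ((K : ℝ) + 1) - 1 = z + K := by ring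
    push_cast
    rw [e]
    linarith

/-- Reflected lower telescoping: `1/w − 1/(w+N+1) ≤ Σ_{m<N+1} 1/(w+N−m)²` for `w > 0`. -/
theorem inv_sub_inv_le_sum_inv_sq_reflect {w : ℝ} (hw : 0 < w) (N : ℕ) :
    1 / w - 1 / (w + N + 1) ≤ ∑ m ∈ Finset.range (N + 1), 1 / (w + N - m) ^ 2 := by
  induction N generalizing w with
  | zero =>
    simp only [zero_add, Finset.sum_range_one, Nat.cast_zero, add_zero, sub_zero]
    have h1 : 0 < w + 1 := by linarith
    rw [div_sub_div _ _ hw.ne' h1.ne', div_le_div_iff₀ (by positivity) (by positivity)]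
    nlinarith
  | succ K ih =>
    rw [Finset.sum_range_succ]
    have hw1 : 0 < w + 1 := by linarith
    have h := ih hw1
    have hK : (0 : ℝ) ≤ K := Nat.cast_nonneg K
    have e1 : ∀ m ∈ Finset.range (K + 1), 1 / (w + 1 + (K : ℝ) - m) ^ 2 = 1 / (w + ((K + 1 : ℕ) : ℝ) - m) ^ 2 := by
      intro m _; push_cast; ring_nf
    rw [Finset.sum_congr rfl e1] at h
    have e2 : 1 / (w + ((K + 1 : ℕ) : ℝ) - ((K + 1 : ℕ) : ℝ)) ^ 2 = 1 / w ^ 2 := by ring_nf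
    rw [e2]
    have hstep : 1 / w - 1 / (w + 1) ≤ 1 / w ^ 2 := by
      rw [div_sub_div _ _ hw.ne' hw1.ne', div_le_div_iff₀ (by positivity) (by positivity)]
      nlinarith
    have e3 : w + 1 + (K : ℝ) + 1 = w + ((K + 1 : ℕ) : ℝ) + 1 := by push_cast; ring
    rw [e3] at h
    linarith

/-- Reflected upper telescoping: `Σ_{m∈Ico 1 N} 1/(w+N−m)² ≤ 1/w − 1/(w+N)` for `w > 0`, `N ≥ 1`. -/
theorem sum_Ico_inv_sq_reflect_le {w : ℝ} (hw : 0 < w) {N : ℕ} (hN : 1 ≤ N) :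
    ∑ m ∈ Finset.Ico 1 N, 1 / (w + N - m) ^ 2 ≤ 1 / w - 1 / (w + N) := by
  induction N, hN using Nat.le_induction generalizing w with
  | base =>
    simp only [Finset.Ico_self, Finset.sum_empty, Nat.cast_one]
    rw [div_sub_div _ _ hw.ne' (by linarith), le_div_iff₀ (by positivity)]; linarith
  | succ K hK ih =>
    rw [Finset.sum_Ico_succ_top hK]
    have hw1 : 0 < w + 1 := by linarith
    have h := ih hw1
    have hK' : (1 : ℝ) ≤ K := by exact_mod_cast hK
    have e1 : ∀ m ∈ Finset.Ico 1 K, 1 / (w + 1 + (K : ℝ) - m) ^ 2 = 1 / (w + ((K + 1 : ℕ) : ℝ) - m) ^ 2 := by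
      intro m _; push_cast; ring_nf
    rw [Finset.sum_congr rfl e1] at h
    have e2 : 1 / (w + ((K + 1 : ℕ) : ℝ) - (K : ℝ)) ^ 2 = 1 / (w + 1) ^ 2 := by push_cast; ring_nf
    rw [e2]
    have hwK : 0 < w + 1 + K := by linarith
    have hstep : 1 / (w + 1) ^ 2 + (1 / (w + 1) - 1 / (w + 1 + K)) ≤ 1 / w - 1 / (w + 1 + K) := by
      have : 1 / (w + 1) ^ 2 + 1 / (w + 1) ≤ 1 / w := by
        rw [div_add_div _ _ (by positivity) hw1.ne', div_le_div_iff₀ (by positivity) hw]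
        nlinarith
      linarith
    have e3 : w + 1 + (K : ℝ) = w + ((K + 1 : ℕ) : ℝ) := by push_cast; ring
    rw [e3] at h hstep
    linarith

/-! ## Off the lattice: the exterior `y < 0` and `y > N` -/

/-- Off the lattice, every lattice term is `(sin²(πy)/π²)/(y−m)²`. -/
theorem sum_sinc_sq_sub_nat_eq {y : ℝ} (hy : ∀ k : ℤ, y ≠ k) (s : Finset ℕ) :
    ∑ m ∈ s, Real.sinc (π * (y - m)) ^ 2 = Real.sin (π * y) ^ 2 / π ^ 2 * ∑ m ∈ s, 1 / (y - m) ^ 2 := by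
  rw [Finset.mul_sum]
  refine Finset.sum_congr rfl fun m _ ↦ ?_
  rw [sinc_sq_sub_nat (sub_nat_ne_zero_of_forall_ne hy m)]
  have hne := sub_nat_ne_zero_of_forall_ne hy m
  have hπ : (π : ℝ) ≠ 0 := Real.pi_pos.ne'
  field_simp

/-- **Exterior majorant, left** (`y < 0`, `y ∉ ℤ`): `0 ≤ M_N(y)`. -/
theorem selbergLattice_nonneg_of_neg {y : ℝ} {N : ℕ} (hy : ∀ k : ℤ, y ≠ k) (h : y < 0) :
    0 ≤ (∑ m ∈ Finset.range (N + 1), Real.sinc (π * (y - m)) ^ 2) -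
      (-1) ^ N * N * (Real.sinc (π * y) * Real.sinc (π * (y - N))) := by
  set z : ℝ := -y with hz
  have hz0 : 0 < z := by linarith
  have hS : 0 ≤ Real.sin (π * y) ^ 2 / π ^ 2 := by positivity
  rw [sub_eq_add_neg, cross_eq (N := N) h.ne (sub_nat_ne_zero_of_forall_ne hy N), sum_sinc_sq_sub_nat_eq hy,
    ← mul_add]
  refine mul_nonneg hS ?_
  have htel := inv_sub_inv_le_sum_inv_sq hz0 (N + 1)
  have hsum : ∑ k ∈ Finset.range (N + 1), 1 / (z + k) ^ 2 = ∑ m ∈ Finset.range (N + 1), 1 / (y - m) ^ 2 :=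
    Finset.sum_congr rfl fun m _ ↦ by rw [hz, show (-y + (m : ℝ)) ^ 2 = (y - m) ^ 2 by ring]
  rw [← hsum]
  have hN0 : (0 : ℝ) ≤ N := Nat.cast_nonneg N
  have e1 : 1 / y = -(1 / z) := by rw [hz]; field_simp
  have e2 : 1 / ((N : ℝ) - y) = 1 / (z + N) := by rw [hz]; ring_nf
  have h3 : 1 / (z + ((N + 1 : ℕ) : ℝ)) ≤ 1 / (z + N) := by
    push_cast
    exact one_div_le_one_div_of_le (by linarith) (by linarith)
  rw [e1, e2]
  linarith

/-- **Exterior minorant, left** (`y < 0`, `y ∉ ℤ`, `N ≥ 1`): `m_N(y) ≤ 0`. -/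
theorem selbergLattice_nonpos_of_neg {y : ℝ} {N : ℕ} (hy : ∀ k : ℤ, y ≠ k) (h : y < 0) (hN : 1 ≤ N) :
    (∑ m ∈ Finset.Ico 1 N, Real.sinc (π * (y - m)) ^ 2) -
      (-1) ^ N * N * (Real.sinc (π * y) * Real.sinc (π * (y - N))) ≤ 0 := by
  set z : ℝ := -y with hz
  have hz0 : 0 < z := by linarith
  have hS : 0 ≤ Real.sin (π * y) ^ 2 / π ^ 2 := by positivity
  rw [sub_eq_add_neg, cross_eq (N := N) h.ne (sub_nat_ne_zero_of_forall_ne hy N), sum_sinc_sq_sub_nat_eq hy,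
    ← mul_add]
  refine mul_nonpos_of_nonneg_of_nonpos hS ?_
  have htel := sum_Ico_inv_sq_le hz0 hN
  have hsum : ∑ m ∈ Finset.Ico 1 N, 1 / (z + m) ^ 2 = ∑ m ∈ Finset.Ico 1 N, 1 / (y - m) ^ 2 :=
    Finset.sum_congr rfl fun m _ ↦ by rw [hz, show (-y + (m : ℝ)) ^ 2 = (y - m) ^ 2 by ring]
  rw [← hsum]
  have hN1 : (1 : ℝ) ≤ N := by exact_mod_cast hN
  have e1 : 1 / y = -(1 / z) := by rw [hz]; field_simp
  have e2 : 1 / ((N : ℝ) - y) = 1 / (z + N) := by rw [hz]; ring_nf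
  have h3 : 1 / (z + N) ≤ 1 / (z + N - 1) := one_div_le_one_div_of_le (by linarith) (by linarith)
  rw [e1, e2]
  linarith

/-- **Exterior majorant, right** (`y > N`, `y ∉ ℤ`): `0 ≤ M_N(y)`. -/
theorem selbergLattice_nonneg_of_gt {y : ℝ} {N : ℕ} (hy : ∀ k : ℤ, y ≠ k) (h : (N : ℝ) < y) :
    0 ≤ (∑ m ∈ Finset.range (N + 1), Real.sinc (π * (y - m)) ^ 2) -
      (-1) ^ N * N * (Real.sinc (π * y) * Real.sinc (π * (y - N))) := by
  set w : ℝ := y - N with hw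
  have hN0 : (0 : ℝ) ≤ N := Nat.cast_nonneg N
  have hw0 : 0 < w := by linarith
  have hy0 : 0 < y := by linarith
  have hS : 0 ≤ Real.sin (π * y) ^ 2 / π ^ 2 := by positivity
  rw [sub_eq_add_neg, cross_eq (N := N) hy0.ne' (sub_nat_ne_zero_of_forall_ne hy N), sum_sinc_sq_sub_nat_eq hy,
    ← mul_add]
  refine mul_nonneg hS ?_
  have htel := inv_sub_inv_le_sum_inv_sq_reflect hw0 N
  have hsum : ∑ m ∈ Finset.range (N + 1), 1 / (w + N - m) ^ 2 = ∑ m ∈ Finset.range (N + 1), 1 / (y - m) ^ 2 :=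
    Finset.sum_congr rfl fun m _ ↦ by rw [hw, show (y - N + (N : ℝ) - m) = y - m by ring]
  rw [← hsum]
  have e1 : 1 / y = 1 / (w + N) := by rw [hw]; ring_nf
  have e2 : 1 / ((N : ℝ) - y) = -(1 / w) := by
    rw [hw, show (N : ℝ) - y = -(y - N) by ring, one_div_neg_eq_neg_one_div]
  have h3 : 1 / (w + N + 1) ≤ 1 / (w + N) := one_div_le_one_div_of_le (by linarith) (by linarith)
  rw [e1, e2]
  linarith

/-- **Exterior minorant, right** (`y > N`, `y ∉ ℤ`, `N ≥ 1`): `m_N(y) ≤ 0`. -/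
theorem selbergLattice_nonpos_of_gt {y : ℝ} {N : ℕ} (hy : ∀ k : ℤ, y ≠ k) (h : (N : ℝ) < y) (hN : 1 ≤ N) :
    (∑ m ∈ Finset.Ico 1 N, Real.sinc (π * (y - m)) ^ 2) -
      (-1) ^ N * N * (Real.sinc (π * y) * Real.sinc (π * (y - N))) ≤ 0 := by
  set w : ℝ := y - N with hw
  have hN1 : (1 : ℝ) ≤ N := by exact_mod_cast hN
  have hw0 : 0 < w := by linarith
  have hy0 : 0 < y := by linarith
  have hS : 0 ≤ Real.sin (π * y) ^ 2 / π ^ 2 := by positivity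
  rw [sub_eq_add_neg, cross_eq (N := N) hy0.ne' (sub_nat_ne_zero_of_forall_ne hy N), sum_sinc_sq_sub_nat_eq hy,
    ← mul_add]
  refine mul_nonpos_of_nonneg_of_nonpos hS ?_
  have htel := sum_Ico_inv_sq_reflect_le hw0 hN
  have hsum : ∑ m ∈ Finset.Ico 1 N, 1 / (w + N - m) ^ 2 = ∑ m ∈ Finset.Ico 1 N, 1 / (y - m) ^ 2 :=
    Finset.sum_congr rfl fun m _ ↦ by rw [hw, show (y - N + (N : ℝ) - m) = y - m by ring]
  rw [← hsum]
  have e1 : 1 / y = 1 / (w + N) := by rw [hw]; ring_nf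
  have e2 : 1 / ((N : ℝ) - y) = -(1 / w) := by
    rw [hw, show (N : ℝ) - y = -(y - N) by ring, one_div_neg_eq_neg_one_div]
  rw [e1, e2]
  linarith

/-! ## On the lattice -/

/-- `sinc(π(k − m)) = 0` for an integer `k` and a natural `m ≠ k`. -/
theorem sinc_pi_mul_int_sub_nat {k : ℤ} {m : ℕ} (h : (m : ℤ) ≠ k) : Real.sinc (π * ((k : ℝ) - m)) = 0 := by
  have e : ((k : ℝ) - m) = ((k - m : ℤ) : ℝ) := by push_cast; ring
  rw [e]
  exact sinc_pi_mul_int_of_ne_zero (sub_ne_zero.2 (Ne.symm h))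

/-- At a lattice point the cross term vanishes. -/
theorem cross_int (k : ℤ) (N : ℕ) :
    (-1 : ℝ) ^ N * N * (Real.sinc (π * k) * Real.sinc (π * ((k : ℝ) - N))) = 0 := by
  rcases Nat.eq_zero_or_pos N with hN | hN
  · subst hN; simp
  · by_cases hk : k = 0
    · subst hk
      have e : (((0 : ℤ) : ℝ) - N) = ((-(N : ℤ) : ℤ) : ℝ) := by push_cast; ring
      rw [e, sinc_pi_mul_int_of_ne_zero (neg_ne_zero.2 (by exact_mod_cast hN.ne'))]
      simp
    · rw [sinc_pi_mul_int_of_ne_zero hk]; simp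

/-- **Lattice majorant**: `𝟙_{[0,N]}(k) ≤ M_N(k)` for `k ∈ ℤ`. -/
theorem indicator_Icc_le_selbergLattice_int (k : ℤ) (N : ℕ) :
    (Icc (0 : ℝ) N).indicator (fun _ ↦ (1 : ℝ)) k ≤
      (∑ m ∈ Finset.range (N + 1), Real.sinc (π * ((k : ℝ) - m)) ^ 2) -
        (-1) ^ N * N * (Real.sinc (π * k) * Real.sinc (π * ((k : ℝ) - N))) := by
  rw [cross_int, sub_zero]
  by_cases hk : ((k : ℝ)) ∈ Icc (0 : ℝ) N
  · rw [indicator_of_mem hk]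
    obtain ⟨h0, hN⟩ := hk
    have h0' : 0 ≤ k := by exact_mod_cast h0
    have hN' : k ≤ N := by exact_mod_cast hN
    have hm0 : k.toNat ∈ Finset.range (N + 1) := by
      rw [Finset.mem_range]; omega
    have hterm : Real.sinc (π * ((k : ℝ) - (k.toNat : ℕ))) ^ 2 = 1 := by
      have : ((k.toNat : ℕ) : ℝ) = k := by
        rw [show ((k.toNat : ℕ) : ℝ) = ((k.toNat : ℤ) : ℝ) by norm_cast, Int.toNat_of_nonneg h0']
      rw [this, sub_self, mul_zero, Real.sinc_zero, one_pow]
    rw [← hterm]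
    exact Finset.single_le_sum (f := fun m : ℕ ↦ Real.sinc (π * ((k : ℝ) - m)) ^ 2)
      (fun m _ ↦ by positivity) hm0
  · rw [indicator_of_notMem hk]
    exact Finset.sum_nonneg fun m _ ↦ by positivity

/-- **Lattice minorant**: `m_N(k) ≤ 𝟙_{(0,N)}(k)` for `k ∈ ℤ`. -/
theorem selbergLattice_le_indicator_Ioo_int (k : ℤ) (N : ℕ) :
    (∑ m ∈ Finset.Ico 1 N, Real.sinc (π * ((k : ℝ) - m)) ^ 2) -
        (-1) ^ N * N * (Real.sinc (π * k) * Real.sinc (π * ((k : ℝ) - N))) ≤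
      (Ioo (0 : ℝ) N).indicator (fun _ ↦ (1 : ℝ)) k := by
  rw [cross_int, sub_zero]
  by_cases hk : ((k : ℝ)) ∈ Ioo (0 : ℝ) N
  · rw [indicator_of_mem hk]
    obtain ⟨h0, hN⟩ := hk
    have h0' : 0 < k := by exact_mod_cast h0
    have hN' : k < N := by exact_mod_cast hN
    have hm0 : k.toNat ∈ Finset.Ico 1 N := by
      rw [Finset.mem_Ico]; omega
    have hcast : ((k.toNat : ℕ) : ℤ) = k := Int.toNat_of_nonneg h0'.le
    rw [Finset.sum_eq_single_of_mem _ hm0 (fun m _ hm ↦ by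
      rw [sinc_pi_mul_int_sub_nat (fun h ↦ hm (by exact_mod_cast (h.trans hcast.symm))), zero_pow two_ne_zero])]
    exact sinc_sq_le_one _
  · rw [indicator_of_notMem hk]
    refine (Finset.sum_eq_zero fun m hm ↦ ?_).le
    rw [Finset.mem_Ico] at hm
    have hne : (m : ℤ) ≠ k := by
      intro h
      apply hk
      rw [← h]
      push_cast
      constructor
      · exact_mod_cast hm.1
      · exact_mod_cast hm.2
    rw [sinc_pi_mul_int_sub_nat hne, zero_pow two_ne_zero]

/-! ## The two inequalities for every `y` -/

/-- **THE LATTICE BEURLING–SELBERG MAJORANT.**  For every `N ∈ ℕ` and every real `y`: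
`𝟙_{[0,N]}(y) ≤ Σ_{m=0}^{N} sinc²(π(y−m)) − (−1)^N N·sinc(πy)·sinc(π(y−N))`. -/
theorem indicator_Icc_le_selbergLattice (N : ℕ) (y : ℝ) :
    (Icc (0 : ℝ) N).indicator (fun _ ↦ (1 : ℝ)) y ≤
      (∑ m ∈ Finset.range (N + 1), Real.sinc (π * (y - m)) ^ 2) -
        (-1) ^ N * N * (Real.sinc (π * y) * Real.sinc (π * (y - N))) := by
  by_cases hint : ∃ k : ℤ, y = k
  · obtain ⟨k, rfl⟩ := hint
    exact indicator_Icc_le_selbergLattice_int k N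
  · push Not at hint
    have hy0 : y ≠ 0 := fun h ↦ hint 0 (by push_cast; exact h)
    have hyN : y ≠ N := fun h ↦ hint N (by push_cast; exact h)
    rcases lt_or_gt_of_ne hy0 with h0 | h0
    · rw [indicator_of_notMem (fun h : y ∈ Icc (0 : ℝ) N ↦ not_le.2 h0 h.1)]
      exact selbergLattice_nonneg_of_neg hint h0
    · rcases lt_or_gt_of_ne hyN with hN | hN
      · rw [indicator_of_mem (show y ∈ Icc (0 : ℝ) N from ⟨h0.le, hN.le⟩)]
        exact one_le_selbergLattice_of_mem_Ioo hint h0 hN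
      · rw [indicator_of_notMem (fun h : y ∈ Icc (0 : ℝ) N ↦ not_le.2 hN h.2)]
        exact selbergLattice_nonneg_of_gt hint hN

/-- **THE LATTICE BEURLING–SELBERG MINORANT.**  For every `N ∈ ℕ` and every real `y`:
`Σ_{m=1}^{N−1} sinc²(π(y−m)) − (−1)^N N·sinc(πy)·sinc(π(y−N)) ≤ 𝟙_{(0,N)}(y)`. -/
theorem selbergLattice_le_indicator_Ioo (N : ℕ) (y : ℝ) :
    (∑ m ∈ Finset.Ico 1 N, Real.sinc (π * (y - m)) ^ 2) -
        (-1) ^ N * N * (Real.sinc (π * y) * Real.sinc (π * (y - N))) ≤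
      (Ioo (0 : ℝ) N).indicator (fun _ ↦ (1 : ℝ)) y := by
  have hind : 0 ≤ (Ioo (0 : ℝ) N).indicator (fun _ ↦ (1 : ℝ)) y :=
    Set.indicator_nonneg (fun _ _ ↦ zero_le_one) _
  rcases Nat.eq_zero_or_pos N with hN0 | hN1
  · subst hN0
    simp
  · by_cases hint : ∃ k : ℤ, y = k
    · obtain ⟨k, rfl⟩ := hint
      exact selbergLattice_le_indicator_Ioo_int k N
    · push Not at hint
      have hy0 : y ≠ 0 := fun h ↦ hint 0 (by push_cast; exact h)
      have hyN : y ≠ N := fun h ↦ hint N (by push_cast; exact h)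
      rcases lt_or_gt_of_ne hy0 with h0 | h0
      · exact (selbergLattice_nonpos_of_neg hint h0 hN1).trans hind
      · rcases lt_or_gt_of_ne hyN with hN | hN
        · rw [indicator_of_mem (show y ∈ Ioo (0 : ℝ) N from ⟨h0, hN⟩)]
          exact selbergLattice_le_one_of_mem_Ioo hint h0 hN
        · exact (selbergLattice_nonpos_of_gt hint hN hN1).trans hind

end Summit.Ventures.WeilGRH

end
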